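import Mathlib
import Summits.Ventures.PercRepro2.Defs
import Summits.Ventures.PercRepro2.Independence
import Summits.Ventures.PercRepro2.Harris
import Summits.Ventures.PercRepro2.Graph
import Summits.Ventures.PercRepro2.Exploration
import Summits.Ventures.PercRepro2.Events
import Summits.Ventures.PercRepro2.FourFunctions
import Summits.Ventures.PercRepro2.Induced
import Summits.Ventures.PercRepro2.Frontier
import Summits.Ventures.PercRepro2.ObsIndependence
import Summits.Ventures.PercRepro2.BHK
import Summits.Ventures.PercRepro2.BHKEvents
import Summits.Ventures.PercRepro2.MultiSource
import Summits.Ventures.PercRepro2.OrderPreservation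
import Summits.Ventures.PercRepro2.SeedSet
import Summits.Ventures.PercRepro2.MultiSourceFun
import Summits.Ventures.PercRepro2.CrossRootT
import Summits.Ventures.PercRepro2.VdBKahn
import Summits.Ventures.PercRepro2.HullDefs
import Summits.Ventures.PercRepro2.CCTRootEdge
import Summits.Ventures.PercRepro2.R1Rung
import Summits.Ventures.PercRepro2.CC2Rung
import Summits.Ventures.PercRepro2.PASubDefs
import Summits.Ventures.PercRepro2.HalfN
import Summits.Ventures.PercRepro2.CCTLin
import Summits.Ventures.PercRepro2.LemmaA
import Summits.Ventures.PercRepro2.BasePrime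
import Summits.Ventures.PercRepro2.BasePendant

/-!
# (CC-T⁻) at an unmarked pendant edge is the BHK slack on `G − e` (blind cell PercRepro2, typer-1;
lead g11 14:08:43Z "(L1-S), (CC-T⁻) ↦ BHK by identity" — the pendant-leaf specialisation of the
prover target `T1 ≥ 0` of row 2′CCT-LIN)

Let `e = {l, u}` be a pendant edge whose leaf `l` carries no other edge and is unmarked
(`l ∉ {s, a, b} ∪ T`). Pinning `e` changes no connection among the other vertices
(`conn_update_leaf_iff`), so `R⁺ = R⁻` (`Rplus_eq_of_leaf`) and the `e`-closed connections under the
`e`-open avoidance are the plain `e`-closed masses: `P(X⁻ ∩ Y⁻ ∩ R⁺) = F₀ᵃᵇ`, `P(X⁻ ∩ R⁺) = F₀ᵃ`,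
`P(R⁺) = P₀`. The cleared (CC-T⁻) expression of `CCTLin.CCTMinus` becomes
`P₀² F₀ᵃᵇ − P₀ (F₀ᵃ F₀ᵇ + F₀ᵇ F₀ᵃ) + F₀ᵃ F₀ᵇ P₀ = P₀ · (P₀ F₀ᵃᵇ − F₀ᵃ F₀ᵇ)`, i.e. `P(R_T)` times the
two-copy BHK slack of `G − e`, which is `MineCLemmas.avoidMore_nonneg` with `U = ∅`:

* **`cctMinus_pendant`**: (CC-T⁻) holds at every unmarked pendant edge (all `n`, all weights).

Together with `CCTMinusEdge.cctMinus_avoided_edge` (edges at `T`) and `CCTMinusRoot` (edges at the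
root), and `L1KPendant.L1K_pendant` for (L1-K), every pendant-leaf specialisation of row 2′CCT-LIN
is a theorem; a falsifier of (CC-T⁻) must use an edge that is neither at `s`, nor at `T`, nor an
unmarked leaf.
-/

namespace Summit.Ventures.PercRepro2

namespace CCTMinusPendant

open PASub HalfN TwoSetRung CCTLin

open scoped Classical

variable {V : Type*} {E : Type*} [Fintype E] [DecidableEq E] [Fintype V] [DecidableEq V]
  {R : Type*} [Field R] [LinearOrder R] [IsStrictOrderedRing R]

variable (p : E → R) (ends : E → Sym2 V) (e : E) (s : V) (T : Finset V)

omit [Fintype E] [Fintype V] [DecidableEq V] in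
/-- At a pendant edge `e = {l, u}` with `l ∉ T ∪ {s}`, the `e`-open avoidance `R⁺` is the
`e`-closed one. -/
lemma Rplus_eq_of_leaf {l u : V} (hf : ends e = s(l, u))
    (hleaf : ∀ e', l ∈ ends e' → e' = e) (hlu : l ≠ u) (hls : l ≠ s) (hlT : l ∉ T) :
    Rplus ends e s T = {ω | Function.update ω e false ∈ avoidAll ends s T} := by
  ext ω
  simp only [Rplus, Set.mem_setOf_eq, avoidAll]
  have key : ∀ (c : Bool) (x : V), x ∈ T →
      (Conn ends (Function.update ω e c) s x ↔ Conn ends ω s x) :=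
    fun c x hx => conn_update_leaf_iff hf hleaf hlu c hls.symm (fun hxl => hlT (hxl ▸ hx))
  constructor
  · intro h x hx
    rw [key false x hx, ← key true x hx]
    exact h x hx
  · intro h x hx
    rw [key true x hx, ← key false x hx]
    exact h x hx

/-- **(CC-T⁻) at an unmarked pendant edge** (`e = {l, u}`, `l` a leaf with `l ∉ {s, a, b} ∪ T`):
the cleared expression is `P₀ · (P₀ F₀ᵃᵇ − F₀ᵃ F₀ᵇ) ≥ 0`, the two-copy BHK slack of `G − e`
(`MineCLemmas.avoidMore_nonneg` with `U = ∅`). -/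
theorem cctMinus_pendant (hp : IsProbVec p) {l u : V} (hf : ends e = s(l, u))
    (hleaf : ∀ e', l ∈ ends e' → e' = e) (hlu : l ≠ u) (hls : l ≠ s) (hlT : l ∉ T) {a b : V}
    (hla : l ≠ a) (hlb : l ≠ b) : CCTMinus p ends e s T a b := by
  unfold CCTMinus
  have hp₀ : IsProbVec (Function.update p e 0) := hp.update e le_rfl zero_le_one
  have key := MineCLemmas.avoidMore_nonneg (Function.update p e 0) ends hp₀ s {a} {b} T ∅
  rw [Finset.union_empty] at key
  simp only [CCT.prob_update_zero_eq] at key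
  unfold massP massF
  rw [CCT.prob_update_zero_eq, CCT.prob_update_zero_eq, CCT.prob_update_zero_eq]
  rw [Rplus_eq_of_leaf ends e s T hf hleaf hlu hls hlT]
  -- the `e`-closed connections under the (now `e`-closed) avoidance
  have e1 : Xminus ends e s a ∩ Xminus ends e s b ∩
      {ω | Function.update ω e false ∈ avoidAll ends s T} =
      {ω | Function.update ω e false ∈ connAll ends s ({a} ∪ {b}) ∩ avoidAll ends s T} := by
    ext ω
    simp only [Xminus, Set.mem_inter_iff, Set.mem_setOf_eq, connAll, Finset.mem_union,
      Finset.mem_singleton]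
    constructor
    · rintro ⟨⟨ha, hb⟩, hR⟩
      refine ⟨fun x hx => ?_, hR⟩
      rcases hx with rfl | rfl
      · exact ha
      · exact hb
    · rintro ⟨h, hR⟩
      exact ⟨⟨h a (Or.inl rfl), h b (Or.inr rfl)⟩, hR⟩
  have e2 : ∀ c : V, Xminus ends e s c ∩ {ω | Function.update ω e false ∈ avoidAll ends s T} =
      {ω | Function.update ω e false ∈ connAll ends s {c} ∩ avoidAll ends s T} := by
    intro c
    ext ω
    simp only [Xminus, Set.mem_inter_iff, Set.mem_setOf_eq, connAll, Finset.mem_singleton,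
      forall_eq]
  have e3 : ∀ c : V, {ω | Function.update ω e false ∈ avoidAll ends s T ∩ connAll ends s {c}} =
      {ω | Function.update ω e false ∈ connAll ends s {c} ∩ avoidAll ends s T} := by
    intro c
    rw [Set.inter_comm]
  rw [e1, e2, e2, e3, e3]
  linarith [key]

end CCTMinusPendant

end Summit.Ventures.PercRepro2
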